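import Summits.Ventures.HSemireg.WedgeHankelRecurrenceDual

/-!
# Venture HSemireg — THE RECURRENCES BEYOND THE WINDOW: A COMPLETE INTERSECTION.  For an affine class `q = dualSeq m a` (`m` monic of degree `r`, `a` a unit modulo `m`) on `[0, N]`,
# `2r ≤ N + 2`, let `b` be THE INVERSE RESIDUE (`a·b ≡ 1 mod m`, `deg b < r`).  Then **`b` is a recurrence of window `N + 3 − r`, and in EVERY degree `k = (N + 2 − r) + j` the recurrences
# are `Rec_k(q) = m · K[X]_{≤ k−r} ⊕ b · K[X]_{≤ j}`** — inside the window (N18) the minimal recurrence `m` alone, beyond it exactly one new generator `b` in degree `N + 2 − r`, coprime to `m`,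
# and nothing else up to `K[X]_{≤ N+1} = m · K[X]_{≤ N+1−r} ⊕ b · K[X]_{≤ r−1}`: the «apolar ideal» of the class is the complete intersection `(m, b)`, `deg m + (N + 2 − deg m) = N + 2`

HONEST FRAMING. Part of the Lean index of the computation cell `pub-hsemireg` (seat p10 gen 27, Sunday typer «UNIFORM-IN-n»).
LINEAR ALGEBRA OF HANKEL (catalecticant) MATRICES and of polynomials over a field ONLY (`Polynomial.modByMonic`): no variety, no cohomology theory, no sheaf, no Ext group and no
semiregularity map is constructed here; nothing here says that HC / HC_CM / HC_AV holds; no Literature fact is declared or used.  Custodian versions as in `WedgeHankelSiegelIdeal` (1/3); the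
dictionary («apolar ideal of a binary form of degree `N` = a complete intersection of degrees `r`, `N + 2 − r`», Macaulay / Iarrobino–Kanev; here for classes without a node at infinity,
the second generator identified as the inverse of the dual residue) is QUOTED, never asserted — the statements below are about the spaces `Rec_k(q)` only.

WHAT IS KEYED.  N32 (`WedgeHankelRecurrenceDual`, № 263): `dualSeq`, `hkFun_dualSeq`, `mem_recSpace_dualSeq_of_dvd`, `exists_dualSeq_of_mem_recSpace`, `rank_hankel1_half_dualSeq_eq_iff_isCoprime`;
N26 (№ 179) `eq_zero_of_forall_coeff_X_pow_mul_modByMonic` (the full non-degeneracy; here its graded form); N23 (№ 176) `recSpace_congr`; N18 (№ 173): `recSpace`, `mem_recSpace_iff`,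
`recSpace_le_degreeLT`, `recSpace_eq_degreeLT_of_lt`, `mem_degreeLT_succ_iff`; `HankelRankOne.hankel1_eq_of_agree` (tree).  Mathlib: `Polynomial.modByMonic_eq_of_dvd_sub`,
`natDegree_modByMonic_lt`, `IsCoprime.dvd_of_dvd_mul_right`.
THIS FILE (namespace `Summit.Ventures.HSemireg.Wedge.HankelOuter` continued; CHAINED on N32; 0 definitions):
* §532 **`coeff_eq_zero_of_forall_coeff_X_pow_mul_modByMonic`** / `mem_degreeLT_of_forall_coeff_X_pow_mul_modByMonic` (GRADED NON-DEGENERACY: `deg ρ < d`, `[X^{d−1}](X^s ρ mod m) = 0`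
  for `s < n ≤ d ⇒ deg ρ < d − n`), `exists_inverse_residue` (`IsCoprime m a ⇒ ∃ b, deg b < d ∧ m ∣ a·b − 1`).
* §533 for `m` monic of degree `r`, `m ∣ a·b − 1`, `deg b < r`, `q = dualSeq m a`: `modByMonic_X_pow_mul_mul_mul_eq`, `isCoprime_pair_of_dvd_mul_sub_one`, `inverse_residue_mul_mem_recSpace` (`deg ρ ≤ j ⇒ ρ·b ∈ Rec_{N+2−r+j}(q)`), **`mem_recSpace_dualSeq_beyond_iff`**
  (`p ∈ Rec_{N+2−r+j}(q) ↔ deg p ≤ N+2−r+j ∧ ∃ ρ, deg ρ ≤ j ∧ m ∣ p − ρ·b`), **`recSpace_dualSeq_beyond_eq_sup`** (`Rec_{N+2−r+j}(q) = m·K[X]_{≤ N+2−2r+j} ⊔ b·K[X]_{≤ j}`, every `j`),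
  **`map_mulRight_inf_map_mulRight_eq_bot`** (`m·K[X]_{≤ c} ⊓ b·K[X]_{≤ r−1} = 0`: the sum is DIRECT up to degree `N + 1`), `degreeLT_eq_sup_of_inverse_residue` (`K[X]_{≤ N+1} = m·K[X]_{≤ N+1−r} ⊔
  b·K[X]_{≤ r−1}`), **`exists_C_mul_add_mul_of_mem_recSpace`** (THE SECOND GENERATOR IS UNIQUE modulo `m` up to a scalar: every `p ∈ Rec_{N+2−r}(q)` is `c·b + g·m`).
* §534 for a CLASS: **`exists_second_generator`** (`R(q) = r`, `m ∈ Rec_r(q)` monic of full degree `r`, `2r ≤ N + 1 ⇒ ∃ b`, `deg b < r`, `IsCoprime m b`, with `Rec_{N+2−r+j}(q) = m·K[X]_{≤…} ⊔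
  b·K[X]_{≤ j}` for every `j` and the sum direct for `j ≤ r − 1`).
READING: N18 described the recurrences INSIDE the window (`k + R ≤ N + 1`: multiples of `m`) and proved the first degree beyond it is strictly bigger; this file describes them BEYOND the
window completely: one more generator, of degree `< r` as a polynomial but «of degree `N + 2 − r`» as a recurrence (it needs that window), equal to the inverse of the dual residue `a`
modulo `m` — so the pair (class ↦ `(m, a)`) of N32 reads (apolar ideal ↦ `(m, a⁻¹ mod m)`).  Classes with a node at infinity: apply after the inversion of N38 or see N34.  Nothing
Ext-side.  New names only.
-/

open Module Polynomial
open scoped Matrix Polynomial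

namespace Summit.Ventures.HSemireg.Wedge.HankelOuter

open Summit.Ventures.HSemireg.Wedge Summit.Ventures.HSemireg.Wedge.Hankel Summit.Ventures.HSemireg.Wedge.HankelRankOne

variable (K : Type*) [Field K] {N : ℕ}

/-! ## §532. Graded non-degeneracy of the residue pairing; the inverse residue -/

/-- **GRADED NON-DEGENERACY: for `m` monic of degree `d`, `deg ρ < d` and `n ≤ d`, if `[X^{d−1}](X^s · ρ mod m) = 0` for all `s < n` then every coefficient of `ρ` of index `≥ d − n`
vanishes** (back-substitution along the anti-diagonal; `n = d` is N26's non-degeneracy). -/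
theorem coeff_eq_zero_of_forall_coeff_X_pow_mul_modByMonic {m : K[X]} (hm : m.Monic) {ρ : K[X]} (hρ : ρ.natDegree < m.natDegree) {n : ℕ} (hn : n ≤ m.natDegree)
    (h : ∀ s < n, (Polynomial.X ^ s * ρ %ₘ m).coeff (m.natDegree - 1) = 0) : ∀ j, m.natDegree - n ≤ j → ρ.coeff j = 0 := by
  have key : ∀ n' ≤ n, ∀ j, m.natDegree - n' ≤ j → ρ.coeff j = 0 := by
    intro n'
    induction n' with
    | zero =>
      intro _ j hj
      exact Polynomial.coeff_eq_zero_of_natDegree_lt (by omega)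
    | succ n' ih =>
      intro hn' j hj
      rcases Nat.lt_or_ge (m.natDegree - (n' + 1)) j with hlt | hle
      · exact ih (by omega) j (by omega)
      · have hna : ρ.natDegree ≤ j := (Polynomial.natDegree_le_iff_coeff_eq_zero).mpr fun i hi => ih (by omega) i (by omega)
        have hlt : (Polynomial.X ^ n' * ρ).natDegree < m.natDegree := by
          have hmul := Polynomial.natDegree_mul_le (p := Polynomial.X ^ n') (q := ρ)
          rw [Polynomial.natDegree_X_pow] at hmul
          omega
        have hself : Polynomial.X ^ n' * ρ %ₘ m = Polynomial.X ^ n' * ρ := (Polynomial.modByMonic_eq_self_iff hm).mpr (Polynomial.degree_lt_degree hlt)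
        have h1 := h n' (by omega)
        rw [hself, Polynomial.coeff_X_pow_mul', if_pos (by omega), show m.natDegree - 1 - n' = j by omega] at h1
        exact h1
  exact key n le_rfl

/-- degree form of the graded non-degeneracy: under the same hypotheses `ρ ∈ K[X]_{< d − n}`. -/
theorem mem_degreeLT_of_forall_coeff_X_pow_mul_modByMonic {m : K[X]} (hm : m.Monic) {ρ : K[X]} (hρ : ρ.natDegree < m.natDegree) {n : ℕ} (hn : n ≤ m.natDegree)
    (h : ∀ s < n, (Polynomial.X ^ s * ρ %ₘ m).coeff (m.natDegree - 1) = 0) : ρ ∈ Polynomial.degreeLT K (m.natDegree - n) := by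
  rw [Polynomial.mem_degreeLT]
  rcases eq_or_ne ρ 0 with h0 | h0
  · rw [h0, Polynomial.degree_zero]; exact WithBot.bot_lt_coe _
  · rw [Polynomial.degree_eq_natDegree h0, Nat.cast_lt]
    by_contra hge
    have := coeff_eq_zero_of_forall_coeff_X_pow_mul_modByMonic K hm hρ hn h ρ.natDegree (by omega)
    exact h0 (Polynomial.leadingCoeff_eq_zero.mp this)

/-- **THE INVERSE RESIDUE: for `IsCoprime m a` (`m` monic) there is `b` with `deg b < deg m` (or `m = 1`) and `m ∣ a·b − 1`.** -/
theorem exists_inverse_residue {m a : K[X]} (hm : m.Monic) (hcop : IsCoprime m a) : ∃ b : K[X], b ∈ Polynomial.degreeLT K m.natDegree ∧ m ∣ a * b - 1 := by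
  obtain ⟨u, v, huv⟩ := hcop
  refine ⟨v %ₘ m, ?_, ?_⟩
  · rw [Polynomial.mem_degreeLT]
    by_cases hm1 : m = 1
    · -- `m = 1`: `v %ₘ 1 = 0`
      rw [hm1, Polynomial.modByMonic_one, Polynomial.degree_zero]; exact WithBot.bot_lt_coe _
    · exact (Polynomial.degree_modByMonic_lt v hm).trans_le (Polynomial.degree_le_natDegree)
  · -- `a (v mod m) − 1 = a v − 1 − a·m·(v / m) = −u m − a m (v / m)`
    have e : a * (v %ₘ m) - 1 = -(m * (u + a * (v /ₘ m))) := by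
      have hv := Polynomial.modByMonic_add_div v m
      linear_combination a * hv + huv
    rw [e, dvd_neg]
    exact dvd_mul_right m _

/-! ## §533. The recurrences of `dualSeq m a` beyond the window: `m·K[X]_{≤ k−r} ⊕ b·K[X]_{≤ k−(N+2−r)}` -/

section Beyond

variable {r : ℕ} {m a b : K[X]} (hm : m.Monic) (hmr : m.natDegree = r) (hb : b ∈ Polynomial.degreeLT K r) (hab : m ∣ a * b - 1)
include hm hmr hb hab

omit hmr hb in
/-- `X^s ρ (a b) ≡ X^s ρ (mod m)`. -/
theorem modByMonic_X_pow_mul_mul_mul_eq (s : ℕ) (ρ : K[X]) :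
    Polynomial.X ^ s * (ρ * b * a) %ₘ m = Polynomial.X ^ s * ρ %ₘ m :=
  Polynomial.modByMonic_eq_of_dvd_sub hm (by
    rw [show Polynomial.X ^ s * (ρ * b * a) - Polynomial.X ^ s * ρ = Polynomial.X ^ s * ρ * (a * b - 1) by ring]
    exact dvd_mul_of_dvd_right hab _)

/-- **the multiples `ρ·b` with `deg ρ ≤ j` are recurrences of window `N + 3 − r + j`: `ρ·b ∈ Rec_{N+2−r+j}(dualSeq m a)`** (for `s ≤ r − 2 − j` the residue `X^s ρ (b a) ≡ X^s ρ` has degree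
`≤ r − 2`, so its top coefficient vanishes). -/
theorem inverse_residue_mul_mem_recSpace (h2 : r + r ≤ N + 2) {j : ℕ} {ρ : K[X]} (hρ : ρ ∈ Polynomial.degreeLT K (j + 1)) :
    ρ * b ∈ recSpace K N (dualSeq K m a) (N + 2 - r + j) := by
  have hbdeg : b = 0 ∨ b.natDegree < r := by
    rcases eq_or_ne b 0 with h0 | h0
    · exact Or.inl h0
    · exact Or.inr ((Polynomial.natDegree_lt_iff_degree_lt h0).mpr (Polynomial.mem_degreeLT.mp hb))
  have hρdeg := (mem_degreeLT_succ_iff K).mp hρ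
  rw [mem_recSpace_iff]
  refine ⟨(mem_degreeLT_succ_iff K).mpr ?_, fun s hs => ?_⟩
  · rcases hbdeg with h0 | hlt
    · rw [h0, mul_zero, Polynomial.natDegree_zero]; exact Nat.zero_le _
    · exact Polynomial.natDegree_mul_le.trans (by omega)
  · rw [hkFun_dualSeq, modByMonic_X_pow_mul_mul_mul_eq K hm hab]
    -- `X^s ρ` has degree `≤ r − 2 < r − 1`: it is its own residue and its `(r−1)`-coefficient is `0`
    rcases eq_or_ne ρ 0 with h0 | h0
    · rw [h0, mul_zero, Polynomial.zero_modByMonic, Polynomial.coeff_zero]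
    · have hlt : (Polynomial.X ^ s * ρ).natDegree < m.natDegree - 1 := by
        rw [Polynomial.natDegree_mul (pow_ne_zero s Polynomial.X_ne_zero) h0, Polynomial.natDegree_X_pow]; omega
      rw [(Polynomial.modByMonic_eq_self_iff hm).mpr (Polynomial.degree_lt_degree (by omega)), Polynomial.coeff_eq_zero_of_natDegree_lt hlt]

omit hm hmr hb in
/-- `IsCoprime m a` and `IsCoprime m b` from `m ∣ a b − 1`. -/
theorem isCoprime_pair_of_dvd_mul_sub_one : IsCoprime m a ∧ IsCoprime m b := by
  obtain ⟨g, hg⟩ := hab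
  exact ⟨⟨-g, b, by linear_combination hg⟩, ⟨-g, a, by linear_combination hg⟩⟩

/-- **MEMBERSHIP BEYOND THE WINDOW: `p ∈ Rec_{N+2−r+j}(dualSeq m a) ↔ deg p ≤ N + 2 − r + j ∧ ∃ ρ, deg ρ ≤ j ∧ m ∣ p − ρ·b`** — the `r − 1 − j` surviving conditions say exactly that the residue
`ρ = p·a mod m` has degree `≤ j` (graded non-degeneracy), and then `p ≡ ρ·b (mod m)`. -/
theorem mem_recSpace_dualSeq_beyond_iff (h2 : r + r ≤ N + 2) {j : ℕ} {p : K[X]} :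
    p ∈ recSpace K N (dualSeq K m a) (N + 2 - r + j) ↔ p ∈ Polynomial.degreeLT K (N + 2 - r + j + 1) ∧ ∃ ρ ∈ Polynomial.degreeLT K (j + 1), m ∣ p - ρ * b := by
  obtain ⟨hcopa, -⟩ := isCoprime_pair_of_dvd_mul_sub_one K hab
  constructor
  · intro hp
    have hdeg := recSpace_le_degreeLT K _ _ hp
    refine ⟨hdeg, (p * a) %ₘ m, ?_, ?_⟩
    · -- the residue `ρ = p a mod m` satisfies the first `r − 1 − j` conditions, hence has degree `≤ j`
      by_cases hm1 : m = 1
      · rw [hm1, Polynomial.modByMonic_one]; exact Submodule.zero_mem _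
      have hρ : ((p * a) %ₘ m).natDegree < m.natDegree := Polynomial.natDegree_modByMonic_lt _ hm hm1
      have hcond : ∀ s < r - 1 - j, (Polynomial.X ^ s * ((p * a) %ₘ m) %ₘ m).coeff (m.natDegree - 1) = 0 := by
        intro s hs
        have e : Polynomial.X ^ s * (p * a %ₘ m) %ₘ m = Polynomial.X ^ s * (p * a) %ₘ m :=
          Polynomial.modByMonic_eq_of_dvd_sub hm (by
            rw [← mul_sub, Polynomial.modByMonic_eq_sub_mul_div (p * a) m, sub_sub_cancel_left, mul_neg, dvd_neg]
            exact dvd_mul_of_dvd_right (dvd_mul_right m _) _)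
        rw [e, ← hkFun_dualSeq]
        exact ((mem_recSpace_iff K).mp hp).2 s (by omega)
      have := mem_degreeLT_of_forall_coeff_X_pow_mul_modByMonic K hm hρ (n := r - 1 - j) (by omega) hcond
      rw [hmr] at this
      exact Polynomial.degreeLT_mono (by omega) this
    · -- `p a ≡ ρ` and `ρ b a ≡ ρ` ⇒ `m ∣ (p − ρ b) a` ⇒ `m ∣ p − ρ b`
      refine hcopa.dvd_of_dvd_mul_right ?_
      have e1 : m ∣ p * a - (p * a) %ₘ m := by
        rw [Polynomial.modByMonic_eq_sub_mul_div (p * a) m, sub_sub_cancel]; exact dvd_mul_right m _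
      have e2 : m ∣ (p * a %ₘ m) * b * a - (p * a) %ₘ m := by
        rw [show (p * a %ₘ m) * b * a - (p * a) %ₘ m = (p * a %ₘ m) * (a * b - 1) by ring]; exact dvd_mul_of_dvd_right hab _
      have := dvd_sub e1 e2
      rwa [show p * a - p * a %ₘ m - (p * a %ₘ m * b * a - p * a %ₘ m) = (p - p * a %ₘ m * b) * a by ring] at this
  · rintro ⟨hdeg, ρ, hρ, g, hg⟩
    -- `p = ρ b + m g`; both summands are recurrences of the window
    have hρb : ρ * b ∈ recSpace K N (dualSeq K m a) (N + 2 - r + j) := inverse_residue_mul_mem_recSpace K hm hmr hb hab h2 hρ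
    have hmg : m * g ∈ Polynomial.degreeLT K (N + 2 - r + j + 1) := by
      rw [← hg]; exact Submodule.sub_mem _ hdeg (recSpace_le_degreeLT K _ _ hρb)
    have e : p = ρ * b + m * g := by rw [← hg]; ring
    rw [e]
    exact Submodule.add_mem _ hρb (mem_recSpace_dualSeq_of_dvd K hm a hmg (dvd_mul_of_dvd_left (dvd_mul_right m g) a))

/-- **THE RECURRENCES BEYOND THE WINDOW: `Rec_{N+2−r+j}(dualSeq m a) = m · K[X]_{≤ N+2−2r+j} ⊔ b · K[X]_{≤ j}`** for every `j` (`2r ≤ N + 2`). -/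
theorem recSpace_dualSeq_beyond_eq_sup (h2 : r + r ≤ N + 2) (j : ℕ) :
    recSpace K N (dualSeq K m a) (N + 2 - r + j)
      = (Polynomial.degreeLT K (N + 2 - r + j - r + 1)).map (LinearMap.mulRight K m) ⊔ (Polynomial.degreeLT K (j + 1)).map (LinearMap.mulRight K b) := by
  refine le_antisymm (fun p hp => ?_) (sup_le ?_ ?_)
  · obtain ⟨hdeg, ρ, hρ, g, hg⟩ := (mem_recSpace_dualSeq_beyond_iff K hm hmr hb hab h2).mp hp
    have hρb : ρ * b ∈ recSpace K N (dualSeq K m a) (N + 2 - r + j) := inverse_residue_mul_mem_recSpace K hm hmr hb hab h2 hρ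
    have hmgdeg : (m * g).natDegree ≤ N + 2 - r + j :=
      (mem_degreeLT_succ_iff K).mp (by rw [← hg]; exact Submodule.sub_mem _ hdeg (recSpace_le_degreeLT K _ _ hρb))
    have hgdeg : g ∈ Polynomial.degreeLT K (N + 2 - r + j - r + 1) := by
      rcases eq_or_ne g 0 with h0 | h0
      · rw [h0]; exact Submodule.zero_mem _
      · rw [Polynomial.natDegree_mul hm.ne_zero h0, hmr] at hmgdeg
        exact (mem_degreeLT_succ_iff K).mpr (by omega)
    have e : p = g * m + ρ * b := by linear_combination hg
    rw [e]
    exact Submodule.add_mem_sup ⟨g, hgdeg, rfl⟩ ⟨ρ, hρ, rfl⟩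
  · rintro _ ⟨g, hg, rfl⟩
    rw [LinearMap.mulRight_apply]
    refine mem_recSpace_dualSeq_of_dvd K hm a ((mem_degreeLT_succ_iff K).mpr ?_) (dvd_mul_of_dvd_left (dvd_mul_left m g) a)
    rcases eq_or_ne g 0 with h0 | h0
    · rw [h0, zero_mul, Polynomial.natDegree_zero]; exact Nat.zero_le _
    · have := (mem_degreeLT_succ_iff K).mp hg
      rw [Polynomial.natDegree_mul h0 hm.ne_zero, hmr]; omega
  · rintro _ ⟨ρ, hρ, rfl⟩
    rw [LinearMap.mulRight_apply]
    exact inverse_residue_mul_mem_recSpace K hm hmr hb hab h2 hρ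

omit hm hmr hb in
/-- **THE SUM IS DIRECT: `m · K[X]_{≤ c} ⊓ b · K[X]_{< r} = 0`** (`b` a unit modulo `m`, `r = deg m`). -/
theorem map_mulRight_inf_map_mulRight_eq_bot (hmr : m.natDegree = r) (c : ℕ) :
    (Polynomial.degreeLT K (c + 1)).map (LinearMap.mulRight K m) ⊓ (Polynomial.degreeLT K r).map (LinearMap.mulRight K b) = ⊥ := by
  obtain ⟨-, hcopb⟩ := isCoprime_pair_of_dvd_mul_sub_one K hab
  rw [Submodule.eq_bot_iff]
  rintro x ⟨⟨g, -, rfl⟩, ⟨ρ, hρ, hx⟩⟩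
  simp only [LinearMap.mulRight_apply] at hx ⊢
  -- `ρ b = g m` ⇒ `m ∣ ρ b` ⇒ `m ∣ ρ` ⇒ `ρ = 0`
  have hdvd : m ∣ ρ := hcopb.dvd_of_dvd_mul_right (by rw [hx]; exact dvd_mul_left m g)
  have hρ0 : ρ = 0 := by
    by_contra h0
    have h1 := Polynomial.natDegree_le_of_dvd hdvd h0
    have h2 := (Polynomial.natDegree_lt_iff_degree_lt h0).mpr (Polynomial.mem_degreeLT.mp hρ)
    omega
  rw [← hx, hρ0, zero_mul]

/-- at the top: **`K[X]_{≤ N+1} = m · K[X]_{≤ N+1−r} ⊔ b · K[X]_{≤ r−1}`** (`1 ≤ r`, `2r ≤ N + 2`; with the previous theorem a direct sum of dimensions `(N + 2 − r) + r`) — division with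
remainder twisted by the unit `b`; as recurrences: every polynomial of degree `≤ N + 1` is a recurrence of the empty window. -/
theorem degreeLT_eq_sup_of_inverse_residue (hr : 1 ≤ r) (h2 : r + r ≤ N + 2) :
    Polynomial.degreeLT K (N + 1 + 1) = (Polynomial.degreeLT K (N + 2 - r)).map (LinearMap.mulRight K m) ⊔ (Polynomial.degreeLT K r).map (LinearMap.mulRight K b) := by
  have h := recSpace_dualSeq_beyond_eq_sup K hm hmr hb hab (N := N) h2 (r - 1)
  rw [show N + 2 - r + (r - 1) = N + 1 by omega, show N + 1 - r + 1 = N + 2 - r by omega, show r - 1 + 1 = r by omega,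
    recSpace_eq_degreeLT_of_lt K (Nat.lt_succ_self N)] at h
  exact h

/-- **THE SECOND GENERATOR IS UNIQUE modulo `m` UP TO A SCALAR: every recurrence of the first window beyond the range of `m`, `p ∈ Rec_{N+2−r}(dualSeq m a)`, is `c · b + g · m`.** -/
theorem exists_C_mul_add_mul_of_mem_recSpace (h2 : r + r ≤ N + 2) {p : K[X]} (hp : p ∈ recSpace K N (dualSeq K m a) (N + 2 - r)) :
    ∃ (c : K) (g : K[X]), p = Polynomial.C c * b + g * m := by
  obtain ⟨-, ρ, hρ, g, hg⟩ := (mem_recSpace_dualSeq_beyond_iff K hm hmr hb hab h2 (j := 0)).mp hp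
  have hρC : ρ = Polynomial.C (ρ.coeff 0) := by
    rcases eq_or_ne ρ 0 with h0 | h0
    · rw [h0, Polynomial.coeff_zero, Polynomial.C_0]
    · exact Polynomial.eq_C_of_natDegree_eq_zero (by
        have := (Polynomial.natDegree_lt_iff_degree_lt h0).mpr (Polynomial.mem_degreeLT.mp hρ); omega)
  exact ⟨ρ.coeff 0, g, by rw [← hρC]; linear_combination hg⟩

end Beyond

/-! ## §534. For a class: the second generator of the recurrences of an affine class of middle rank `r` -/

/-- **THE SECOND GENERATOR.  For a class `q` of middle rank `r` whose monic minimal recurrence `m` has full degree `r` (no node at infinity) and `2r ≤ N + 1`: `q = dualSeq m a` on `[0, N]` with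
`a` a unit modulo `m`, and for the inverse residue `b` (`deg b < r`, `a·b ≡ 1`): `Rec_{N+2−r+j}(q) = m · K[X]_{≤ N+2−2r+j} ⊔ b · K[X]_{≤ j}` for every `j`, the sum direct (`m·K[X]_{≤c} ⊓ b·K[X]_{<r}
= 0`) — the recurrences of `q` in all degrees `≤ N + 1` are generated by the complete intersection `(m, b)`.** -/
theorem exists_second_generator {r : ℕ} {q : ℕ → K} {m : K[X]} (hq : (hankel1 K N (N / 2) q).rank = r) (hm : m ∈ recSpace K N q r) (hmo : m.Monic)
    (hmr : m.natDegree = r) (h2 : r + r ≤ N + 1) :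
    ∃ a b : K[X], IsCoprime m a ∧ (∀ j ≤ N, q j = dualSeq K m a j) ∧ b ∈ Polynomial.degreeLT K r ∧ m ∣ a * b - 1 ∧
      (∀ j, recSpace K N q (N + 2 - r + j)
          = (Polynomial.degreeLT K (N + 2 - r + j - r + 1)).map (LinearMap.mulRight K m) ⊔ (Polynomial.degreeLT K (j + 1)).map (LinearMap.mulRight K b)) ∧
      (∀ c, (Polynomial.degreeLT K (c + 1)).map (LinearMap.mulRight K m) ⊓ (Polynomial.degreeLT K r).map (LinearMap.mulRight K b) = ⊥) := by
  classical
  obtain ⟨a, -, haff⟩ := exists_dualSeq_of_mem_recSpace K hmo (q := q) (by rw [hmr]; exact hm)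
  have hR : (hankel1 K N (N / 2) (dualSeq K m a)).rank = m.natDegree := by
    rw [← hankel1_eq_of_agree (Nat.div_le_self N 2) haff, hq, hmr]
  have hcop : IsCoprime m a := (rank_hankel1_half_dualSeq_eq_iff_isCoprime K hmo (by rw [hmr]; omega)).mp hR
  obtain ⟨b, hb, hab⟩ := exists_inverse_residue K hmo hcop
  rw [hmr] at hb
  refine ⟨a, b, hcop, haff, hb, hab, fun j => ?_, fun c => map_mulRight_inf_map_mulRight_eq_bot K hab hmr c⟩
  rw [recSpace_congr K haff]
  exact recSpace_dualSeq_beyond_eq_sup K hmo hmr hb hab (by omega) j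


end Summit.Ventures.HSemireg.Wedge.HankelOuter
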